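import Summits.QuantumFields.GaugeBoot.Certificates.KZL2HD4TabA
import HarnessLib

/-!
# Reduced problem family `KZL2HD4`: binding interface (gb_lean_emit_win 0.10)

HONEST FRAMING (cell `pub-gaugeboot`): certified bounds on lattice expectations at stated coupling,
gauge group, dimension and torus size; NOT a mass gap, NOT a continuum limit, NOT a string tension;
NOT Yang–Mills-summit-bearing (barriers `FixedCouplingUltralocality`, `PerturbativeInvisibility`).
Family `KZL2HD4` (signature sha256 `e00fafe4caba89145c77c71e7e721b914a808131ca3b0d1762729b1a4ed325d2`): the INTERFACE a lattice binding consumes — `dim`, `ent`,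
`redBlock` (reduced block `k` as a real matrix-valued linear form in its own dimension), `redBlock_eq` (= `Sparse.redE KZL2HD4.EB …`,
the form in the certificate modules' hypotheses) and `redBlock_apply`. Nothing is claimed about lattice gauge theory here.
-/

namespace Summit.QuantumFields.GaugeBoot.Certificates.KZL2HD4

noncomputable section

open Matrix Summit.QuantumFields.GaugeBoot.Certificates.Sparse

/-- Dimension of reduced block `k`. -/
def dim (k : Fin 30) : ℕ := dimL.getD k.val 0

/-- The combination `[(w, c), …]` at entry `(i, j)` of reduced block `k` (symmetric; empty outside the block). -/
def ent (k : Fin 30) (i j : ℕ) : List (ℕ × ℤ) := Sparse.ent EB k.val i j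

/-- **Reduced block `k` as a real matrix-valued linear form** in its own dimension `dim k`. -/
def redBlock (k : Fin 30) (y : Fin 2306 → ℝ) : Matrix (Fin (dim k)) (Fin (dim k)) ℝ :=
  Sparse.redE EB k.val (dim k) 2306 y

/-- `redBlock` unfolds to `Sparse.redE` (the form used by the certificate modules). -/
theorem redBlock_eq (k : Fin 30) (y : Fin 2306 → ℝ) :
    redBlock k y = Sparse.redE EB k.val (dimL.getD k.val 0) 2306 y := rfl

/-- **Binding interface**: `redBlock k y i j = Σ_{(w,c) ∈ ent k i j} c · y_w`. -/
theorem redBlock_apply (k : Fin 30) (y : Fin 2306 → ℝ) (i j : Fin (dim k)) :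
    redBlock k y i j = Sparse.evalComb (ent k i.val j.val) y := rfl

end

end Summit.QuantumFields.GaugeBoot.Certificates.KZL2HD4
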